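import Summits.QuantumFields.QCD.Theses.HeatSlicedQuarks
import Summits.QuantumFields.QCD.Theorems.HeatSlicedQuarksActionBoundsLowModes
import Literature.MathematicalPhysics.QuantumLattice.FinDimSpectrumClusterGapProofs
import Literature.MathematicalPhysics.QuantumLattice.DuhamelTwoPoint
import Mathlib.Analysis.SpecialFunctions.Integrals.Basic
import Mathlib.Analysis.SpecialFunctions.Exp

/-!
# `QuarkSliceStability` — Bałaban-format lower stability of the quark heat slice
# (item stmt-QuantumFields-17987, route HeatSlicedQuarks, support)

**Statement (as filed).**  There is an absolute `C` such that for every torus side `L`, every `SU(3)`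
link field `U` on `(ℤ/L)⁴`, every bare mass `m ∈ [-1/2, 1]`, every `s ≥ 1` and every `b ≥ 1`,
`∫_s^{bs} (Re tr e^{-tH_U} − Re tr e^{-tH_1}) dt/t ≤ C L⁴/s² + C (S_W(U) + 1) log b`,
`H_U = D_W(U,m,1)ᴴ D_W(U,m,1)`, `H_1` the same for the trivial field, `S_W` the tree's `wilsonAction`.

**Proof (Laplace transform of the mode count, as announced in the item).**
* The CLOSED crux `ActionBoundsLowModes` (item 8872, theorem
  `Cruxes.ActionBoundsLowModes.DropTheWilsonSquare.ActionBoundsLowModes_of`) bounds the dimension of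
  every subspace on which `‖D_W v‖² ≤ λ‖v‖²` by `C(λ²L⁴ + S_W + 1)`; applied to the span of the
  eigenvectors of `H_U` with eigenvalue `≤ λ` (variational counting,
  `Literature…FinDimSpectrumClusterGapProofs`) this is the Weyl–CLR mode count
  `N_U(λ) ≤ C(λ²L⁴ + S_W + 1)` (`sliceStab_card_eigenvalues_le`).
* Unit energy bands `k ≤ tλ_i < k + 1`: `Σ_i e^{-tλ_i} ≤ Σ_k e^{-k} N_U((k+1)/t)
  ≤ c₁ C L⁴/t² + c₂ C (S_W + 1)` with the absolute series `c₁ = 2Σ k²e^{-k} + 2Σ e^{-k}`,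
  `c₂ = Σ e^{-k}` (`sliceStab_sum_exp_le`); `Re tr e^{-tH} = Σ_i e^{-tλ_i}`
  (`Matrix.IsHermitian.partitionFn_eq_ofReal`) and the free trace is `≥ 0`, so it is dropped.
* `∫_s^{bs} (P/t³ + Q/t) dt ≤ P/s² + Q log b` (`sliceStab_integral_le`, antiderivative `-t⁻¹`).

No definitions, no named facts: unconditional (axioms those of the crux proof).  References:
Vafa–Witten 1984 (mode counting against action), Bałaban 1988 (format of the stability bound).
-/

namespace Summit.QuantumFields.QCD.Theorems.HeatSlicedQuarks

open Literature.MathematicalPhysics Literature.MathematicalPhysics.QuantumLattice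
  Literature.MathematicalPhysics.QuantumFieldTheory Literature.Probability.LatticeModels
open Matrix Finset MeasureTheory
open scoped ComplexOrder InnerProductSpace

/-! ## Mode counting from the subspace form of the crux -/

section Counting

variable {n : Type*} [Fintype n] [DecidableEq n]

/-- **Variational counting against a subspace bound.**  If every subspace `E ⊆ ℂⁿ` on which
`‖Dv‖² ≤ a‖v‖²` has `dim E ≤ N`, then `H = Dᴴ D` has at most `N` eigenvalues `≤ a`: the span of the
corresponding eigenvectors is such a subspace (`finrank_eigSpan`,
`re_inner_le_mul_norm_sq_of_mem_eigSpan`, transported along `WithLp.linearEquiv`). -/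
theorem sliceStab_card_eigenvalues_le (D : Matrix n n ℂ) {a N : ℝ}
    (h : ∀ E : Submodule ℂ (n → ℂ), (∀ v ∈ E, ∑ i, ‖(D *ᵥ v) i‖ ^ 2 ≤ a * ∑ i, ‖v i‖ ^ 2) →
      (Module.finrank ℂ E : ℝ) ≤ N) :
    ((univ.filter fun i => (isHermitian_conjTranspose_mul_self D).eigenvalues i ≤ a).card : ℝ) ≤
      N := by
  have hH : (Dᴴ * D).IsHermitian := isHermitian_conjTranspose_mul_self D
  set S : Finset n := univ.filter fun i => hH.eigenvalues i ≤ a with hS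
  set K : Submodule ℂ (EuclideanSpace ℂ n) :=
    Submodule.span ℂ (Set.range fun i : S => hH.eigenvectorBasis i) with hK
  set E : Submodule ℂ (n → ℂ) :=
    K.map (WithLp.linearEquiv 2 ℂ (n → ℂ) : EuclideanSpace ℂ n →ₗ[ℂ] (n → ℂ)) with hE
  have hKE : Module.finrank ℂ E = S.card := by
    rw [hE, LinearEquiv.finrank_map_eq, hK, finrank_eigSpan]
  have hEv : ∀ v ∈ E, ∑ i, ‖(D *ᵥ v) i‖ ^ 2 ≤ a * ∑ i, ‖v i‖ ^ 2 := by
    intro v hv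
    obtain ⟨x, hx, rfl⟩ := Submodule.mem_map.mp hv
    have h1 := re_inner_le_mul_norm_sq_of_mem_eigSpan hH (S := S) (a := a)
      (fun i hi => (mem_filter.mp hi).2) hx
    have h2 : ∑ i, ‖(D *ᵥ (WithLp.ofLp x)) i‖ ^ 2 =
        RCLike.re ⟪x, toEuclideanLin (Dᴴ * D) x⟫_ℂ := by
      rw [sum_norm_sq_mulVec_eq_re, EuclideanSpace.inner_eq_star_dotProduct, ofLp_toLpLin,
        Matrix.toLin'_apply, dotProduct_comm]
      rfl
    have h3 : ‖x‖ ^ 2 = ∑ i, ‖(WithLp.ofLp x) i‖ ^ 2 := EuclideanSpace.norm_sq_eq x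
    rw [LinearEquiv.coe_coe, WithLp.coe_linearEquiv, h2, ← h3]
    exact h1
  calc ((univ.filter fun i => (isHermitian_conjTranspose_mul_self D).eigenvalues i ≤ a).card : ℝ)
      = S.card := by rw [hS]
    _ = (Module.finrank ℂ E : ℝ) := by rw [hKE]
    _ ≤ N := h E hEv

end Counting

/-! ## Heat trace from the mode count (unit energy bands) -/

section Bands

variable {n : Type*} [Fintype n]

/-- **Laplace transform of a quadratic mode count, discretised.**  If `λ_i ≥ 0` and
`#{i | λ_i ≤ a} ≤ A a² + B` for all `a ≥ 0` (`A, B ≥ 0`), then for `t > 0`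
`Σ_i e^{-tλ_i} ≤ (2Σ_k k²e^{-k} + 2Σ_k e^{-k}) · A/t² + (Σ_k e^{-k}) · B`.
Proof: group the indices by the band `k = ⌊tλ_i⌋`; on band `k`, `e^{-tλ_i} ≤ e^{-k}` and the band
lies in `{λ_i ≤ (k+1)/t}`, of size `≤ A(k+1)²/t² + B`; finally `(k+1)² ≤ 2k² + 2` and the finite
band sums are dominated by the full series. -/
theorem sliceStab_sum_exp_le (lam : n → ℝ) (hlam : ∀ i, 0 ≤ lam i) {A B : ℝ}
    (hA : 0 ≤ A) (hB : 0 ≤ B)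
    (hN : ∀ a : ℝ, 0 ≤ a → ((univ.filter fun i => lam i ≤ a).card : ℝ) ≤ A * a ^ 2 + B)
    {t : ℝ} (ht : 0 < t) :
    ∑ i, Real.exp (-(t * lam i)) ≤
      (2 * ∑' k : ℕ, (k : ℝ) ^ 2 * Real.exp (-1 * k) + 2 * ∑' k : ℕ, Real.exp (-(k : ℝ))) *
          (A / t ^ 2) + (∑' k : ℕ, Real.exp (-(k : ℝ))) * B := by
  classical
  -- the unit energy bands `k = ⌊t λ_i⌋`
  set φ : n → ℕ := fun i => ⌊t * lam i⌋₊ with hφ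
  have hband : ∀ i, (φ i : ℝ) ≤ t * lam i ∧ t * lam i < φ i + 1 := fun i =>
    ⟨Nat.floor_le (mul_nonneg ht.le (hlam i)), Nat.lt_floor_add_one _⟩
  -- summability of the band weights
  have hs1 : Summable fun k : ℕ => (k : ℝ) ^ 2 * Real.exp (-1 * k) :=
    Real.summable_pow_mul_exp_neg_nat_mul 2 one_pos
  have hs2 : Summable fun k : ℕ => Real.exp (-(k : ℝ)) := Real.summable_exp_neg_nat
  -- each band is a sublevel set of the counting function
  have hfib : ∀ k : ℕ, ∑ i ∈ univ.filter (fun i => φ i = k), Real.exp (-(t * lam i)) ≤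
      (A / t ^ 2) * (2 * ((k : ℝ) ^ 2 * Real.exp (-1 * k)) + 2 * Real.exp (-(k : ℝ))) +
        B * Real.exp (-(k : ℝ)) := by
    intro k
    have hsub : univ.filter (fun i => φ i = k) ⊆ univ.filter (fun i => lam i ≤ (k + 1) / t) := by
      intro i hi
      simp only [mem_filter, mem_univ, true_and] at hi ⊢
      rw [le_div_iff₀ ht, mul_comm]
      have := (hband i).2
      rw [hi] at this
      exact this.le
    have hcard : ((univ.filter fun i => φ i = k).card : ℝ) ≤ A * ((k + 1) / t) ^ 2 + B :=
      (Nat.cast_le.mpr (card_le_card hsub)).trans (hN _ (by positivity))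
    calc ∑ i ∈ univ.filter (fun i => φ i = k), Real.exp (-(t * lam i))
        ≤ ∑ i ∈ univ.filter (fun i => φ i = k), Real.exp (-(k : ℝ)) := by
          refine sum_le_sum fun i hi => Real.exp_le_exp.mpr (neg_le_neg ?_)
          have hik : φ i = k := (mem_filter.mp hi).2
          rw [← hik]
          exact (hband i).1
      _ = ((univ.filter fun i => φ i = k).card : ℝ) * Real.exp (-(k : ℝ)) := by
          rw [sum_const, nsmul_eq_mul]
      _ ≤ (A * ((k + 1) / t) ^ 2 + B) * Real.exp (-(k : ℝ)) :=
          mul_le_mul_of_nonneg_right hcard (Real.exp_pos _).le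
      _ = (A / t ^ 2) * (((k : ℝ) + 1) ^ 2 * Real.exp (-(k : ℝ))) + B * Real.exp (-(k : ℝ)) := by
          field_simp
      _ ≤ (A / t ^ 2) * (2 * ((k : ℝ) ^ 2 * Real.exp (-1 * k)) + 2 * Real.exp (-(k : ℝ))) +
            B * Real.exp (-(k : ℝ)) := by
          have hk2 : ((k : ℝ) + 1) ^ 2 ≤ 2 * (k : ℝ) ^ 2 + 2 := by nlinarith [sq_nonneg ((k : ℝ) - 1)]
          have he : 0 ≤ Real.exp (-(k : ℝ)) := (Real.exp_pos _).le
          have h1k : Real.exp (-1 * (k : ℝ)) = Real.exp (-(k : ℝ)) := by rw [neg_one_mul]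
          rw [h1k]
          have hAt : 0 ≤ A / t ^ 2 := by positivity
          nlinarith [mul_le_mul_of_nonneg_right hk2 he, hAt]
  -- resum over the bands
  rw [← sum_fiberwise_of_maps_to (s := univ) (t := univ.image φ) (g := φ)
    (fun i hi => mem_image_of_mem φ hi) (fun i => Real.exp (-(t * lam i)))]
  calc ∑ k ∈ univ.image φ, ∑ i ∈ univ.filter (fun i => φ i = k), Real.exp (-(t * lam i))
      ≤ ∑ k ∈ univ.image φ, ((A / t ^ 2) * (2 * ((k : ℝ) ^ 2 * Real.exp (-1 * k)) +
          2 * Real.exp (-(k : ℝ))) + B * Real.exp (-(k : ℝ))) := sum_le_sum fun k _ => hfib k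
    _ = (A / t ^ 2) * (2 * ∑ k ∈ univ.image φ, (k : ℝ) ^ 2 * Real.exp (-1 * k) +
          2 * ∑ k ∈ univ.image φ, Real.exp (-(k : ℝ))) +
          B * ∑ k ∈ univ.image φ, Real.exp (-(k : ℝ)) := by
        simp only [sum_add_distrib, ← mul_sum]
    _ ≤ (A / t ^ 2) * (2 * ∑' k : ℕ, (k : ℝ) ^ 2 * Real.exp (-1 * k) +
          2 * ∑' k : ℕ, Real.exp (-(k : ℝ))) + B * ∑' k : ℕ, Real.exp (-(k : ℝ)) := by
        have i1 : ∑ k ∈ univ.image φ, (k : ℝ) ^ 2 * Real.exp (-1 * k) ≤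
            ∑' k : ℕ, (k : ℝ) ^ 2 * Real.exp (-1 * k) :=
          hs1.sum_le_tsum _ fun k _ => by positivity
        have i2 : ∑ k ∈ univ.image φ, Real.exp (-(k : ℝ)) ≤ ∑' k : ℕ, Real.exp (-(k : ℝ)) :=
          hs2.sum_le_tsum _ fun k _ => (Real.exp_pos _).le
        have hAt : 0 ≤ A / t ^ 2 := by positivity
        gcongr
    _ = _ := by ring

end Bands

/-! ## The proper-time window integral -/

section Window

/-- `∫_a^b t⁻² dt = a⁻¹ - b⁻¹` for `0 < a ≤ b` (antiderivative `-t⁻¹`). -/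
theorem sliceStab_integral_inv_sq {a b : ℝ} (ha : 0 < a) (hab : a ≤ b) :
    ∫ t in a..b, (t ^ 2)⁻¹ = a⁻¹ - b⁻¹ := by
  have hderiv : ∀ t ∈ Set.uIcc a b, HasDerivAt (fun s : ℝ => 0 - s⁻¹) ((t ^ 2)⁻¹) t := fun t ht => by
    rw [Set.uIcc_of_le hab] at ht
    have ht0 : t ≠ 0 := (ha.trans_le ht.1).ne'
    have h := (hasDerivAt_inv ht0).const_sub 0
    rwa [neg_neg] at h
  have hcont : ContinuousOn (fun t : ℝ => (t ^ 2)⁻¹) (Set.uIcc a b) := by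
    refine ContinuousOn.inv₀ (by fun_prop) fun t ht => ?_
    rw [Set.uIcc_of_le hab] at ht
    exact pow_ne_zero 2 (ha.trans_le ht.1).ne'
  rw [intervalIntegral.integral_eq_sub_of_hasDerivAt hderiv (hcont.intervalIntegrable)]
  ring

/-- **The window integral.**  If `p, q` are continuous, `q ≥ 0`, and `p(t) ≤ P/t² + Q` for `t > 0`
(`P ≥ 0`), then for `s ≥ 1`, `b ≥ 1`:
`∫_s^{bs} (p(t) − q(t)) dt/t ≤ P/s² + Q log b` — on `[s, bs]` the integrand is at most
`(P/s) t⁻² + Q t⁻¹`, whose integral is `(P/s)(s⁻¹ − (bs)⁻¹) + Q log b`. -/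
theorem sliceStab_integral_le {p q : ℝ → ℝ} {P Q s b : ℝ} (hs : 1 ≤ s) (hb : 1 ≤ b)
    (hP : 0 ≤ P) (hp : Continuous p) (hq : Continuous q) (hq0 : ∀ t, 0 ≤ q t)
    (hpt : ∀ t, 0 < t → p t ≤ P / t ^ 2 + Q) :
    ∫ t in s..(b * s), (p t - q t) / t ≤ P / s ^ 2 + Q * Real.log b := by
  have hs0 : 0 < s := by linarith
  have hsb : s ≤ b * s := le_mul_of_one_le_left hs0.le hb
  have hI : ∀ t ∈ Set.uIcc s (b * s), 0 < t := fun t ht => by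
    rw [Set.uIcc_of_le hsb] at ht
    linarith [ht.1]
  have h0 : (0 : ℝ) ∉ Set.uIcc s (b * s) := fun h => lt_irrefl _ (hI 0 h)
  -- integrability
  have hfi : IntervalIntegrable (fun t => (p t - q t) / t) volume s (b * s) :=
    (((hp.sub hq).continuousOn).div continuousOn_id (fun t ht => (hI t ht).ne')).intervalIntegrable
  have hgi1 : IntervalIntegrable (fun t : ℝ => (t ^ 2)⁻¹) volume s (b * s) :=
    intervalIntegral.intervalIntegrable_inv (fun t ht => pow_ne_zero 2 (hI t ht).ne')
      (continuousOn_pow 2)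
  have hgi2 : IntervalIntegrable (fun t : ℝ => t⁻¹) volume s (b * s) :=
    intervalIntegral.intervalIntegrable_inv (fun t ht => (hI t ht).ne') continuousOn_id
  have hgi : IntervalIntegrable (fun t : ℝ => P / s * (t ^ 2)⁻¹ + Q * t⁻¹) volume s (b * s) :=
    (hgi1.const_mul _).add (hgi2.const_mul _)
  -- pointwise domination on the window
  have hpw : ∀ t ∈ Set.Icc s (b * s), (p t - q t) / t ≤ P / s * (t ^ 2)⁻¹ + Q * t⁻¹ := by
    intro t ht
    have ht0 : 0 < t := by linarith [ht.1]
    have h1 : (p t - q t) / t ≤ (P / t ^ 2 + Q) / t := by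
      gcongr
      linarith [hpt t ht0, hq0 t]
    have h2 : (P / t ^ 2 + Q) / t = P / (t ^ 2 * t) + Q * t⁻¹ := by
      rw [add_div, div_div, div_eq_mul_inv Q t]
    have h3 : P / (t ^ 2 * t) ≤ P / s * (t ^ 2)⁻¹ := by
      calc P / (t ^ 2 * t) ≤ P / (t ^ 2 * s) :=
            div_le_div_of_nonneg_left hP (by positivity) (mul_le_mul_of_nonneg_left ht.1 (sq_nonneg t))
        _ = P / s * (t ^ 2)⁻¹ := by rw [mul_comm (t ^ 2) s, ← div_div, div_eq_mul_inv (P / s)]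
    linarith
  -- integrate
  calc ∫ t in s..(b * s), (p t - q t) / t
      ≤ ∫ t in s..(b * s), (P / s * (t ^ 2)⁻¹ + Q * t⁻¹) :=
        intervalIntegral.integral_mono_on hsb hfi hgi hpw
    _ = P / s * (s⁻¹ - (b * s)⁻¹) + Q * Real.log b := by
        rw [intervalIntegral.integral_add (hgi1.const_mul _) (hgi2.const_mul _),
          intervalIntegral.integral_const_mul, intervalIntegral.integral_const_mul,
          integral_inv h0, mul_div_cancel_right₀ b hs0.ne', sliceStab_integral_inv_sq hs0 hsb]
    _ ≤ P / s ^ 2 + Q * Real.log b := by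
        have h1 : 0 ≤ P / s * (b * s)⁻¹ := by positivity
        have h2 : P / s * s⁻¹ = P / s ^ 2 := by field_simp
        nlinarith

end Window

/-! ## The item -/

/-- **`QuarkSliceStability`** (item stmt-QuantumFields-17987 of route HeatSlicedQuarks, as stated): there
is an absolute `C` such that for every `L`, every `SU(3)` field `U`, every `m ∈ [-1/2, 1]`, every
`s ≥ 1` and `b ≥ 1`,
`∫_s^{bs} (Re tr e^{-tH_U} − Re tr e^{-tH_1}) dt/t ≤ C L⁴/s² + C (S_W(U) + 1) log b`.
Here `C = (2Σk²e^{-k} + 3Σe^{-k}) · max(C₀, 0)` with `C₀` the constant of the proved crux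
`ActionBoundsLowModes`.  Proof: mode count from the crux (`sliceStab_card_eigenvalues_le`), heat trace
by unit bands (`sliceStab_sum_exp_le`), spectral representation of `Re tr e^{-tH}`
(`Matrix.IsHermitian.partitionFn_eq_ofReal`), free trace `≥ 0` dropped, window integral
(`sliceStab_integral_le`). -/
theorem QuarkSliceStability_proof :
    Summit.QuantumFields.QCD.Theses.HeatSlicedQuarks.QuarkSliceStability := by
  classical
  -- the crux constant, made nonnegative
  obtain ⟨C₀, hC₀⟩ :=
    Summit.QuantumFields.QCD.Cruxes.ActionBoundsLowModes.DropTheWilsonSquare.ActionBoundsLowModes_of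
  set C : ℝ := max C₀ 0
  have hC0 : 0 ≤ C := le_max_right _ _
  have hC : ActionBoundsLowModes.Negative.ActionBoundsLowModesWith C :=
    ActionBoundsLowModes.Negative.ActionBoundsLowModesWith.mono hC₀ (le_max_left _ _)
  -- the absolute band series
  set σ₁ : ℝ := ∑' k : ℕ, (k : ℝ) ^ 2 * Real.exp (-1 * k)
  set σ₂ : ℝ := ∑' k : ℕ, Real.exp (-(k : ℝ))
  have hσ₁0 : 0 ≤ σ₁ := tsum_nonneg fun k => by positivity
  have hσ₂0 : 0 ≤ σ₂ := tsum_nonneg fun k => (Real.exp_pos _).le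
  refine ⟨(2 * σ₁ + 3 * σ₂) * C, ?_⟩
  intro L _ U m hm s hs b hb
  set D := wilsonDirac (fundamentalRep (Fin 3)) U m 1
  set D₁ := wilsonDirac (fundamentalRep (Fin 3))
    (fun _ : Edge 4 L => (1 : ↥(Matrix.specialUnitaryGroup (Fin 3) ℂ))) m 1
  have hH : (Dᴴ * D).IsHermitian := isHermitian_conjTranspose_mul_self D
  have hH₁ : (D₁ᴴ * D₁).IsHermitian := isHermitian_conjTranspose_mul_self D₁
  have hP : (Dᴴ * D).PosSemidef := posSemidef_conjTranspose_mul_self D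
  have hlam0 : ∀ i, 0 ≤ hH.eigenvalues i := fun i => hP.eigenvalues_nonneg i
  set SW : ℝ := wilsonAction (fundamentalRep (Fin 3)) U
  have hSW0 : 0 ≤ SW := ActionBoundsLowModes.Negative.wilsonAction_nonneg L U
  have hL : (0 : ℝ) ≤ (L : ℝ) ^ 4 := by positivity
  -- Step 1: the mode count `N_U(a) ≤ C (a² L⁴ + S_W + 1)`
  have hcount : ∀ a : ℝ, 0 ≤ a →
      ((univ.filter fun i => hH.eigenvalues i ≤ a).card : ℝ) ≤
        C * (L : ℝ) ^ 4 * a ^ 2 + C * (SW + 1) := by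
    intro a ha
    have h := sliceStab_card_eigenvalues_le D (a := a) (N := C * (a ^ 2 * (L : ℝ) ^ 4 + SW + 1))
      (fun E hE => hC L U m hm a ha E hE)
    calc _ ≤ C * (a ^ 2 * (L : ℝ) ^ 4 + SW + 1) := h
      _ = _ := by ring
  -- Step 2: the heat trace `Σ e^{-tλ} ≤ c₁ C L⁴/t² + c₂ C (S_W + 1)`
  have htrace : ∀ t : ℝ, 0 < t → ∑ i, Real.exp (-(t * hH.eigenvalues i)) ≤
      (2 * σ₁ + 2 * σ₂) * (C * (L : ℝ) ^ 4 / t ^ 2) + σ₂ * (C * (SW + 1)) := fun t ht =>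
    sliceStab_sum_exp_le hH.eigenvalues hlam0 (mul_nonneg hC0 hL) (mul_nonneg hC0 (by linarith))
      hcount ht
  -- Step 3: spectral representation of the two traces
  have hre : ∀ t : ℝ, (Matrix.trace (NormedSpace.exp (-(t : ℂ) • (Dᴴ * D)))).re =
      ∑ i, Real.exp (-(t * hH.eigenvalues i)) := fun t => by
    have h := hH.partitionFn_eq_ofReal t
    have h' : Matrix.trace (NormedSpace.exp (-(t : ℂ) • (Dᴴ * D))) = partitionFn t (Dᴴ * D) := rfl
    rw [h', h, Complex.ofReal_re]
  have hre₁ : ∀ t : ℝ, (Matrix.trace (NormedSpace.exp (-(t : ℂ) • (D₁ᴴ * D₁)))).re =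
      ∑ i, Real.exp (-(t * hH₁.eigenvalues i)) := fun t => by
    have h := hH₁.partitionFn_eq_ofReal t
    have h' : Matrix.trace (NormedSpace.exp (-(t : ℂ) • (D₁ᴴ * D₁))) = partitionFn t (D₁ᴴ * D₁) :=
      rfl
    rw [h', h, Complex.ofReal_re]
  -- continuity and sign
  have hpc : Continuous fun t : ℝ => (Matrix.trace (NormedSpace.exp (-(t : ℂ) • (Dᴴ * D)))).re := by
    have hc : Continuous fun t : ℝ => ∑ i, Real.exp (-(t * hH.eigenvalues i)) := by fun_prop
    exact hc.congr fun t => (hre t).symm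
  have hqc : Continuous fun t : ℝ => (Matrix.trace (NormedSpace.exp (-(t : ℂ) • (D₁ᴴ * D₁)))).re := by
    have hc : Continuous fun t : ℝ => ∑ i, Real.exp (-(t * hH₁.eigenvalues i)) := by fun_prop
    exact hc.congr fun t => (hre₁ t).symm
  have hq0 : ∀ t : ℝ, 0 ≤ (Matrix.trace (NormedSpace.exp (-(t : ℂ) • (D₁ᴴ * D₁)))).re := fun t => by
    rw [hre₁ t]
    exact sum_nonneg fun i _ => (Real.exp_pos _).le
  have hpt : ∀ t : ℝ, 0 < t → (Matrix.trace (NormedSpace.exp (-(t : ℂ) • (Dᴴ * D)))).re ≤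
      (2 * σ₁ + 2 * σ₂) * (C * (L : ℝ) ^ 4) / t ^ 2 + σ₂ * (C * (SW + 1)) := fun t ht => by
    rw [hre t, mul_div_assoc]
    exact htrace t ht
  -- Step 4: the window integral
  have hPQ := sliceStab_integral_le (P := (2 * σ₁ + 2 * σ₂) * (C * (L : ℝ) ^ 4))
    (Q := σ₂ * (C * (SW + 1))) hs hb (mul_nonneg (by linarith) (mul_nonneg hC0 hL)) hpc hqc hq0 hpt
  refine hPQ.trans ?_
  have hlog : 0 ≤ Real.log b := Real.log_nonneg hb
  have hs2 : 0 < s ^ 2 := by positivity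
  have e1 : (2 * σ₁ + 2 * σ₂) * (C * (L : ℝ) ^ 4) / s ^ 2 ≤ (2 * σ₁ + 3 * σ₂) * C * (L : ℝ) ^ 4 / s ^ 2 := by
    rw [div_le_div_iff_of_pos_right hs2]
    nlinarith [mul_nonneg hσ₂0 (mul_nonneg hC0 hL)]
  have e2 : σ₂ * (C * (SW + 1)) * Real.log b ≤ (2 * σ₁ + 3 * σ₂) * C * (SW + 1) * Real.log b := by
    refine mul_le_mul_of_nonneg_right ?_ hlog
    have : 0 ≤ C * (SW + 1) := by positivity
    nlinarith [mul_nonneg hσ₁0 this, mul_nonneg hσ₂0 this]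
  linarith

end Summit.QuantumFields.QCD.Theorems.HeatSlicedQuarks
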